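import Summits.RiemannHypothesis.RiemannHypothesis.Theorems.IntegerScrewCensusBracketsPrimal
import Summits.RiemannHypothesis.RiemannHypothesis.Theorems.ScrewManifestCert

/-!
# Route `IntegerScrew` — the FIRST COMPLETE census rung in the kernel: `T_DD(8) ∈ (20, 22]`

`Rung 7 20 22 = ¬ ManifestCert 7 (1/10) 20 ∧ ManifestCert 7 (1/10) 22` (conjunct 1 of
`CensusBracketsCertified`, `Theorems/ScrewManifestCertDefs.lean`): the `lo` side is the tree's
`floorAtEight_20 : FloorAtEight 20` (sos-theory gen16, the `M = 8` dual of record); the `hi` side is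
proved HERE by the primal checker `pcCheck` of `IntegerScrewCensusBracketsPrimal` on the census
certificate of cell `M008-T22-dd` (HOME/sos/census/engine-B/ddcone/cells/M008-T22-dd/cert.json,
rh-explicit-sos-eng-2 gen2: 7 wave atoms `t_k ∈ {289/125, …, 5263/250} ⊂ [0.1, 22]`, dyadic weights,
`w_J = 7563640015293/2^48`, remainder margin·M ≥ 0.103 there; the kernel re-encloses `S_8` and the
atoms itself and decides the row test).  RH-FREE finite statement about Suzuki's `S_8`; nothing here
bears on the truth of RH. [Suzuki2023]
-/

set_option linter.dupNamespace false
set_option autoImplicit false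

namespace Summit.RiemannHypothesis.RiemannHypothesis.Theorems.IntegerScrew.Manifest

section Rung8

/-- Atom frequencies `t_k` of the census certificate M008-T22-dd (sos-cert/v1, rh-explicit-sos-eng-2). -/
def ts8 : List ℚ := [289/125, 579/250, 846/125, 1294/125, 1769/125, 3539/250, 5263/250]

/-- Reduced weights `ω_k = w_k/t_k²` of the census certificate M008-T22-dd. -/
def os8 : List ℚ := [4789385340765625/23509071529850699776, 90801274740828125/23590488166864257024,
  2318869972859375/25182018053930483712, 245220363110265625/471311834103483990016,
  1358514243807921875/880836814594235170816, 9592270016838015625/881334814196780498944,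
  349290789772671875/60911116790465036288]

/-- All-ones weight `w_J` of the census certificate M008-T22-dd. -/
def wJ8 : ℚ := 7563640015293/281474976710656

set_option maxRecDepth 200000 in
/-- KERNEL COMPUTATION: the primal checker accepts the M008-T22 certificate. -/
theorem pcCheck_8_22 : pcCheck 7 ts8 os8 wJ8 (1 / 10) 22 = true := by
  decide +kernel

/-- **PROVED (KERNEL): `ManifestCert 7 (1/10) 22`** — `S_8` has a manifest certificate at height `22`. -/
theorem manifestCert_7_22 : ManifestCert 7 (1 / 10) 22 := by
  have h := manifestCert_of_pcCheck (by norm_num) (by norm_num) pcCheck_8_22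
  norm_num at h
  exact h

/-- **PROVED (KERNEL): the census rung `T_DD(8) ∈ (20, 22]`** (`Rung 7 20 22`, conjunct 1 of
`CensusBracketsCertified`): no manifest certificate of `S_8` at height `20` (tree `floorAtEight_20`),
one at height `22` (`manifestCert_7_22`). -/
theorem censusRung_8 : Rung 7 20 22 :=
  ⟨floorAtEight_20 (1 / 10) (by norm_num), manifestCert_7_22⟩

end Rung8

end Summit.RiemannHypothesis.RiemannHypothesis.Theorems.IntegerScrew.Manifest
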